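import Summits.NavierStokesRegularity.NavierStokesRegularity.Theses.SlicedKelvin
import Summits.NavierStokesRegularity.NavierStokesRegularity.Theorems.SlicedKelvinPlanarFluxAPrioriStubDecayPersistence
import Summits.NavierStokesRegularity.NavierStokesRegularity.Theorems.SlicedKelvinPlanarFluxAPrioriStubFluxOfCubicDecay
import Summits.NavierStokesRegularity.NavierStokesRegularity.Theorems.SlicedKelvinPlanarFluxAPrioriStubVorticityMassBound
import Summits.NavierStokesRegularity.NavierStokesRegularity.Theorems.SlicedKelvinPlanarFluxAPrioriStubSlabSplit
import Summits.NavierStokesRegularity.NavierStokesRegularity.Theorems.SlicedKelvinPlanarFluxAPrioriStubApexLipschitz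
import Literature.Analysis.FluidPDE.ConstantinDirectionDissipationProofs

/-!
# Crux `SlicedKelvin.PlanarFluxAPriori` (stmt-NavierStokesRegularity-15600), line `Sketch`
# (card halfspace-apex-identity): the closed REDUCTION of the crux to the slab apex bound

Support file (`--supports stmt-NavierStokesRegularity-15600`). The line `Sketch`
(`Cruxes/PlanarFluxAPriori/Lines/Sketch.lean`) cuts the crux — the unsigned vorticity flux through every
plane stays bounded along a classical Leray–Hopf solution from a rapidly decaying datum — into

* the short-time window `[0, T/2]`, paid by decay persistence (`stub_decayPersistence`, landed) and the
  kinematic flux bound `stub_fluxOfCubicDecay` (landed);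
* the window `[T/2, T)`, where the SLAB SPLIT `Φ(c) ≤ ‖ω·n‖_{L¹(ℝ³)}/(2h) + liminf_{ε→0⁺} τ^ε(S_h(c))`
  (`stub_slabSplit`, landed; it takes the apex Lipschitz law `stub_apexLipschitz` as a hypothesis) is
  combined with Constantin's a-priori `L¹` vorticity bound (`stub_vorticityMassBound`, landed) and with
  the OPEN transfer target of the card, the slab apex bound `stub_slabApexBound`.

Here we record, sorry-free, the composition `planarFluxAPriori_of_apexStubs` (all six statements as
hypotheses; pure `ℝ≥0∞` bookkeeping) and the reduction
`planarFluxAPriori_of_apexLipschitz_of_slabApexBound : ApexLipschitz → SlabApexBound → PlanarFluxAPriori`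
with the four landed stubs plugged in by name, so that the crux is formally reduced to the two remaining
registered stubs of the line (the kinematic Lipschitz law, in flight, and the open slab apex bound).
-/

noncomputable section

namespace Summit.NavierStokesRegularity.NavierStokesRegularity.Theorems.SlicedKelvinPlanarFluxAPriori

-- the summit and its single sub-problem share the name (CONVENTIONS §1), as in every Theorems file
set_option linter.dupNamespace false

open MeasureTheory Set Filter Literature.Analysis.FluidPDE
open scoped ENNReal NNReal Topology

/-- `‖⟪a, R e₂⟫‖ₑ ≤ ‖a‖ₑ`: the normal component is at most the modulus (the frame vector is a unit vector). -/
theorem apex_enorm_inner_frame_le (R : EuclideanSpace ℝ (Fin 3) ≃ₗᵢ[ℝ] EuclideanSpace ℝ (Fin 3))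
    (a : EuclideanSpace ℝ (Fin 3)) :
    ‖inner ℝ a (R (EuclideanSpace.single 2 1))‖ₑ ≤ ‖a‖ₑ := by
  rw [Real.enorm_eq_ofReal_abs, ← ofReal_norm]
  refine ENNReal.ofReal_le_ofReal ?_
  calc |inner ℝ a (R (EuclideanSpace.single 2 1))|
      ≤ ‖a‖ * ‖R (EuclideanSpace.single 2 (1 : ℝ))‖ := abs_real_inner_le_norm _ _
    _ = ‖a‖ := by rw [LinearIsometryEquiv.norm_map, PiLp.norm_single, norm_one, mul_one]

/-- Finiteness of Constantin's bound `‖curl u₀‖₁ + (2ν)⁻¹‖u₀‖₂²` in the crux class (rapid decay of the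
smooth datum gives `curl u₀ ∈ L¹`; the Leray–Hopf class gives `u₀ ∈ L²`). -/
theorem apex_constantinBound_lt_top {ν T : ℝ} (hν : 0 < ν) (hT : 0 < T)
    {u : ℝ → EuclideanSpace ℝ (Fin 3) → EuclideanSpace ℝ (Fin 3)} {p : ℝ → EuclideanSpace ℝ (Fin 3) → ℝ}
    (hcl : IsClassicalNSSolutionOn (Set.Ico 0 T) ν 0 u p) (hLH : IsLerayHopfOn T ν 0 (u 0) u)
    (hdec : HasRapidSpatialDecay (u 0)) :
    (∫⁻ x, ‖curl (u 0) x‖ₑ) + (ENNReal.ofReal (2 * ν))⁻¹ * ∫⁻ x, ‖u 0 x‖ₑ ^ 2 < ⊤ := by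
  have h0T : (0 : ℝ) ∈ Set.Ico 0 T := ⟨le_rfl, hT⟩
  have hc1 : ContDiff ℝ 1 (u 0) := contDiff_infty.1 (hcl.contDiff_velocity h0T) 1
  have hω : ∫⁻ x, ‖curl (u 0) x‖ₑ < ⊤ := by
    have h := (integrable_norm_curl_of_hasRapidSpatialDecay hc1 hdec).hasFiniteIntegral
    simpa only [HasFiniteIntegral, enorm_norm] using h
  have hu2 : ∫⁻ x, ‖u 0 x‖ₑ ^ 2 < ⊤ := by
    have hmem : MemLp (u 0) 2 volume := hLH.memLp 0 ⟨le_rfl, hT.le⟩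
    have h := lintegral_rpow_enorm_lt_top_of_eLpNorm_lt_top (by norm_num) (by norm_num) hmem.eLpNorm_lt_top
    simpa only [ENNReal.toReal_ofNat, ENNReal.rpow_ofNat] using h
  have hinv : (ENNReal.ofReal (2 * ν))⁻¹ < ⊤ := by
    rw [ENNReal.inv_lt_top, ENNReal.ofReal_pos]
    positivity
  exact ENNReal.add_lt_top.2 ⟨hω, ENNReal.mul_lt_top hinv hu2⟩

/-- **Composition of line `Sketch`, closed form.** The stub STATEMENTS of the line (as hypotheses: the
kinematic flux bound `h1`, Constantin's bound `h2`, the slab split `h4`, the slab apex bound `h5`, decay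
persistence `hdp`) imply the crux statement (conclusion = the body of `Theses.SlicedKelvin.PlanarFluxAPriori`,
verbatim): on `[0, T/2]` the flux is bounded by decay
persistence and `stub_fluxOfCubicDecay`; on `[T/2, T)` by the slab split, Constantin's `L¹` bound and the
slab apex bound; `M := (6C₀·I₂ + A₀/(2h) + M_apex).toReal`, all three pieces finite. -/
theorem planarFluxAPriori_of_apexStubs
    (h1 : ∀ (v : EuclideanSpace ℝ (Fin 3) → EuclideanSpace ℝ (Fin 3)) (C : ℝ),
      (∀ x : EuclideanSpace ℝ (Fin 3), (1 + ‖x‖) ^ 3 * ‖iteratedFDeriv ℝ 1 v x‖ ≤ C) →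
      ∀ (R : EuclideanSpace ℝ (Fin 3) ≃ₗᵢ[ℝ] EuclideanSpace ℝ (Fin 3)) (c : ℝ),
        ∫⁻ y : EuclideanSpace ℝ (Fin 2), ‖inner ℝ (Literature.Analysis.FluidPDE.curl v
          (R (WithLp.toLp 2 ![y 0, y 1, c]))) (R (EuclideanSpace.single 2 1))‖ₑ ≤
        ENNReal.ofReal (6 * C) * ∫⁻ y : EuclideanSpace ℝ (Fin 2), ENNReal.ofReal ((1 + ‖y‖) ^ (-(3 : ℝ))))
    (h2 : ∀ (ν T : ℝ), 0 < ν → 0 < T → ∀ (u : ℝ → EuclideanSpace ℝ (Fin 3) → EuclideanSpace ℝ (Fin 3))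
      (p : ℝ → EuclideanSpace ℝ (Fin 3) → ℝ),
      Literature.Analysis.FluidPDE.IsClassicalNSSolutionOn (Set.Ico 0 T) ν 0 u p →
      Literature.Analysis.FluidPDE.IsLerayHopfOn T ν 0 (u 0) u →
      Literature.Analysis.FluidPDE.HasRapidSpatialDecay (u 0) →
      ∀ t ∈ Set.Ico 0 T, ∫⁻ x, ‖Literature.Analysis.FluidPDE.curl (u t) x‖ₑ ≤
        (∫⁻ x, ‖Literature.Analysis.FluidPDE.curl (u 0) x‖ₑ) +
          (ENNReal.ofReal (2 * ν))⁻¹ * ∫⁻ x, ‖u 0 x‖ₑ ^ 2)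
    (h4 : ∀ (R : EuclideanSpace ℝ (Fin 3) ≃ₗᵢ[ℝ] EuclideanSpace ℝ (Fin 3)) (c h : ℝ), 0 < h →
      ∀ (v : EuclideanSpace ℝ (Fin 3) → EuclideanSpace ℝ (Fin 3)), ContDiff ℝ (⊤ : ℕ∞) v →
      (∃ C : ℝ, ∀ (x : EuclideanSpace ℝ (Fin 3)) (k : ℕ), k ≤ 3 →
        (1 + ‖x‖) ^ 3 * ‖iteratedFDeriv ℝ k v x‖ ≤ C) →
      ∫⁻ y : EuclideanSpace ℝ (Fin 2), ‖inner ℝ (Literature.Analysis.FluidPDE.curl v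
          (R (WithLp.toLp 2 ![y 0, y 1, c]))) (R (EuclideanSpace.single 2 1))‖ₑ ≤
      ENNReal.ofReal (1 / (2 * h)) *
          (∫⁻ x, ‖inner ℝ (Literature.Analysis.FluidPDE.curl v x) (R (EuclideanSpace.single 2 1))‖ₑ) +
        Filter.liminf (fun ε : ℝ => ∫⁻ x in {x : EuclideanSpace ℝ (Fin 3) |
            |inner ℝ x (R (EuclideanSpace.single 2 1)) - c| < h},
          ENNReal.ofReal (ε ^ 2 / Real.sqrt (inner ℝ (Literature.Analysis.FluidPDE.curl v x)
            (R (EuclideanSpace.single 2 1)) ^ 2 + ε ^ 2) ^ 3 *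
            |fderiv ℝ (fun z => inner ℝ (Literature.Analysis.FluidPDE.curl v z) (R (EuclideanSpace.single 2 1)))
              x (Literature.Analysis.FluidPDE.curl v x)|)) (nhdsWithin 0 (Set.Ioi 0)))
    (h5 : ∀ (ν T : ℝ), 0 < ν → 0 < T → ∀ (u : ℝ → EuclideanSpace ℝ (Fin 3) → EuclideanSpace ℝ (Fin 3))
      (p : ℝ → EuclideanSpace ℝ (Fin 3) → ℝ),
      Literature.Analysis.FluidPDE.IsClassicalNSSolutionOn (Set.Ico 0 T) ν 0 u p →
      Literature.Analysis.FluidPDE.IsLerayHopfOn T ν 0 (u 0) u →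
      Literature.Analysis.FluidPDE.HasRapidSpatialDecay (u 0) →
      ∀ t₀ ∈ Set.Ioo 0 T, ∃ M : NNReal, ∃ h : ℝ, 0 < h ∧ ∀ t ∈ Set.Ico t₀ T,
        ∀ (R : EuclideanSpace ℝ (Fin 3) ≃ₗᵢ[ℝ] EuclideanSpace ℝ (Fin 3)) (c : ℝ),
        Filter.liminf (fun ε : ℝ => ∫⁻ x in {x : EuclideanSpace ℝ (Fin 3) |
            |inner ℝ x (R (EuclideanSpace.single 2 1)) - c| < h},
          ENNReal.ofReal (ε ^ 2 / Real.sqrt (inner ℝ (Literature.Analysis.FluidPDE.curl (u t) x)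
            (R (EuclideanSpace.single 2 1)) ^ 2 + ε ^ 2) ^ 3 *
            |fderiv ℝ (fun z => inner ℝ (Literature.Analysis.FluidPDE.curl (u t) z) (R (EuclideanSpace.single 2 1)))
              x (Literature.Analysis.FluidPDE.curl (u t) x)|)) (nhdsWithin 0 (Set.Ioi 0)) ≤ (M : ENNReal))
    (hdp : ∀ (ν T : ℝ), 0 < ν → 0 < T → ∀ (u : ℝ → EuclideanSpace ℝ (Fin 3) → EuclideanSpace ℝ (Fin 3))
      (p : ℝ → EuclideanSpace ℝ (Fin 3) → ℝ),
      Literature.Analysis.FluidPDE.IsClassicalNSSolutionOn (Set.Ico 0 T) ν 0 u p →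
      Literature.Analysis.FluidPDE.IsLerayHopfOn T ν 0 (u 0) u →
      Literature.Analysis.FluidPDE.HasRapidSpatialDecay (u 0) → ∀ t ∈ Set.Ico 0 T, ∃ C₀ : ℝ,
      ∀ s ∈ Set.Icc 0 t, ∀ (x : EuclideanSpace ℝ (Fin 3)) (k : ℕ), k ≤ 3 →
        (1 + ‖x‖) ^ 3 * ‖iteratedFDeriv ℝ k (u s) x‖ ≤ C₀) :
    ∀ (ν T : ℝ), 0 < ν → 0 < T → ∀ (u : ℝ → EuclideanSpace ℝ (Fin 3) → EuclideanSpace ℝ (Fin 3)) (p : ℝ →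
      EuclideanSpace ℝ (Fin 3) → ℝ), Literature.Analysis.FluidPDE.IsClassicalNSSolutionOn (Set.Ico 0 T) ν 0
      u p → Literature.Analysis.FluidPDE.IsLerayHopfOn T ν 0 (u 0) u →
      Literature.Analysis.FluidPDE.HasRapidSpatialDecay (u 0) → ∃ M : ℝ, ∀ t ∈ Set.Ico 0 T, ∀ (R :
      EuclideanSpace ℝ (Fin 3) ≃ₗᵢ[ℝ] EuclideanSpace ℝ (Fin 3)) (c : ℝ), ∫⁻ y : EuclideanSpace ℝ (Fin 2),
      ‖inner ℝ (Literature.Analysis.FluidPDE.curl (u t) (R (WithLp.toLp 2 ![y 0, y 1, c]))) (R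
      (EuclideanSpace.single 2 1))‖ₑ ≤ ENNReal.ofReal M := by
  intro ν T hν hT u p hcl hLH hdec
  have ht₀ : T / 2 ∈ Set.Ioo 0 T := ⟨by positivity, by linarith⟩
  have ht₀' : T / 2 ∈ Set.Ico 0 T := ⟨by positivity, by linarith⟩
  -- decay on the window `[0, T/2]`
  obtain ⟨C₀, hC₀⟩ := hdp ν T hν hT u p hcl hLH hdec (T / 2) ht₀'
  -- the apex bound on `[T/2, T)`
  obtain ⟨M, h, hh, hM⟩ := h5 ν T hν hT u p hcl hLH hdec (T / 2) ht₀
  -- the three finite constants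
  set I₂ : ℝ≥0∞ := ∫⁻ y : EuclideanSpace ℝ (Fin 2), ENNReal.ofReal ((1 + ‖y‖) ^ (-(3 : ℝ))) with hI₂
  have hI₂_lt : I₂ < ⊤ :=
    finite_integral_one_add_norm (by rw [finrank_euclideanSpace_fin]; norm_num)
  set A₀ : ℝ≥0∞ := (∫⁻ x, ‖curl (u 0) x‖ₑ) + (ENNReal.ofReal (2 * ν))⁻¹ * ∫⁻ x, ‖u 0 x‖ₑ ^ 2 with hA₀
  have hA₀_lt : A₀ < ⊤ := apex_constantinBound_lt_top hν hT hcl hLH hdec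
  set K : ℝ≥0∞ := ENNReal.ofReal (6 * C₀) * I₂ + (ENNReal.ofReal (1 / (2 * h)) * A₀ + (M : ℝ≥0∞)) with hK
  have hK_lt : K < ⊤ := by
    refine ENNReal.add_lt_top.2 ⟨ENNReal.mul_lt_top ENNReal.ofReal_lt_top hI₂_lt,
      ENNReal.add_lt_top.2 ⟨ENNReal.mul_lt_top ENNReal.ofReal_lt_top hA₀_lt, ENNReal.coe_lt_top⟩⟩
  refine ⟨K.toReal, fun t ht R c => ?_⟩
  rw [ENNReal.ofReal_toReal hK_lt.ne]
  rcases lt_or_ge t (T / 2) with hlt | hge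
  · -- the short-time window: decay persistence + the kinematic flux bound
    have hs : t ∈ Set.Icc 0 (T / 2) := ⟨ht.1, hlt.le⟩
    exact (h1 (u t) C₀ (fun x => hC₀ t hs x 1 (by norm_num)) R c).trans le_self_add
  · -- `t ∈ [T/2, T)`: slab split + Constantin + apex bound
    have ht' : t ∈ Set.Ico (T / 2) T := ⟨hge, ht.2⟩
    obtain ⟨C₁, hC₁⟩ := hdp ν T hν hT u p hcl hLH hdec t ht
    have hdecay : ∃ C : ℝ, ∀ (x : EuclideanSpace ℝ (Fin 3)) (k : ℕ), k ≤ 3 →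
        (1 + ‖x‖) ^ 3 * ‖iteratedFDeriv ℝ k (u t) x‖ ≤ C :=
      ⟨C₁, fun x k hk => hC₁ t ⟨ht.1, le_rfl⟩ x k hk⟩
    have hsmooth : ContDiff ℝ (⊤ : ℕ∞) (u t) := hcl.contDiff_velocity ht
    have hfn : ∫⁻ x, ‖inner ℝ (curl (u t) x) (R (EuclideanSpace.single 2 1))‖ₑ ≤ A₀ :=
      (lintegral_mono fun x => apex_enorm_inner_frame_le R (curl (u t) x)).trans
        (h2 ν T hν hT u p hcl hLH hdec t ht)
    calc ∫⁻ y : EuclideanSpace ℝ (Fin 2), ‖inner ℝ (curl (u t) (R (WithLp.toLp 2 ![y 0, y 1, c])))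
          (R (EuclideanSpace.single 2 1))‖ₑ
        ≤ ENNReal.ofReal (1 / (2 * h)) *
            (∫⁻ x, ‖inner ℝ (curl (u t) x) (R (EuclideanSpace.single 2 1))‖ₑ) + _ :=
          h4 R c h hh (u t) hsmooth hdecay
      _ ≤ ENNReal.ofReal (1 / (2 * h)) * A₀ + (M : ℝ≥0∞) :=
          add_le_add (by gcongr) (hM t ht' R c)
      _ ≤ K := le_add_self


/-- **The crux reduced to the two remaining stubs of line `Sketch`.** The apex Lipschitz law (statement of the
registered stub `stub_apexLipschitz`) and the slab apex bound (statement of the registered stub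
`stub_slabApexBound`, the card's transfer target C⁺ in positive-time form) imply
`Theses.SlicedKelvin.PlanarFluxAPriori`, the four other stubs being the landed theorems
`stub_fluxOfCubicDecay`, `stub_vorticityMassBound`, `stub_slabSplit`, `stub_decayPersistence`. -/
theorem planarFluxAPriori_of_apexLipschitz_of_slabApexBound :
    (∀ (ε : ℝ), 0 < ε → ∀ (R : EuclideanSpace ℝ (Fin 3) ≃ₗᵢ[ℝ] EuclideanSpace ℝ (Fin 3)) (c c' : ℝ) (v : EuclideanSpace ℝ (Fin 3) → EuclideanSpace ℝ (Fin 3)), ContDiff ℝ (⊤ : ℕ∞) v → (∃ C : ℝ, ∀ (x : EuclideanSpace ℝ (Fin 3)) (k : ℕ), k ≤ 3 → (1 + ‖x‖) ^ 3 * ‖iteratedFDeriv ℝ k v x‖ ≤ C) → ∫ y : EuclideanSpace ℝ (Fin 2), inner ℝ (Literature.Analysis.FluidPDE.curl v (R (WithLp.toLp 2 ![y 0, y 1, c]))) (R (EuclideanSpace.single 2 1)) ^ 2 / Real.sqrt (inner ℝ (Literature.Analysis.FluidPDE.curl v (R (WithLp.toLp 2 ![y 0, y 1, c]))) (R (EuclideanSpace.single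 2 1)) ^ 2 + ε ^ 2) ≤ (∫ y : EuclideanSpace ℝ (Fin 2), inner ℝ (Literature.Analysis.FluidPDE.curl v (R (WithLp.toLp 2 ![y 0, y 1, c']))) (R (EuclideanSpace.single 2 1)) ^ 2 / Real.sqrt (inner ℝ (Literature.Analysis.FluidPDE.curl v (R (WithLp.toLp 2 ![y 0, y 1, c']))) (R (EuclideanSpace.single 2 1)) ^ 2 + ε ^ 2)) + ∫ x in {x : EuclideanSpace ℝ (Fin 3) | inner ℝ x (R (EuclideanSpace.single 2 1)) ∈ Set.uIcc c c'}, ε ^ 2 / Real.sqrt (inner ℝ (Literature.Analysis.FluidPDE.curl v x) (R (EuclideanSpace.single 2 1)) ^ 2 + ε ^ 2) ^ 3 * |fderiv ℝ (fun z => inner ℝ (Literature.Analysis.FluidPDE.curl v z) (R (EuclideanSpace.single 2 1))) x (Literature.Analysis.FluidPDE.curl v x)|) → (∀ (ν T : ℝ), 0 < ν → 0 < T → ∀ (u : ℝ → EuclideanSpace ℝ (Fin 3) → EuclideanSpace ℝ (Fin 3)) (p : ℝ → EuclideanSpace ℝ (Fin 3) → ℝ), Literature.Analysis.FluidPDE.IsClassicalNSSolutionOn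 (Set.Ico 0 T) ν 0 u p → Literature.Analysis.FluidPDE.IsLerayHopfOn T ν 0 (u 0) u → Literature.Analysis.FluidPDE.HasRapidSpatialDecay (u 0) → ∀ t₀ ∈ Set.Ioo 0 T, ∃ M : NNReal, ∃ h : ℝ, 0 < h ∧ ∀ t ∈ Set.Ico t₀ T, ∀ (R : EuclideanSpace ℝ (Fin 3) ≃ₗᵢ[ℝ] EuclideanSpace ℝ (Fin 3)) (c : ℝ), Filter.liminf (fun ε : ℝ => ∫⁻ x in {x : EuclideanSpace ℝ (Fin 3) | |inner ℝ x (R (EuclideanSpace.single 2 1)) - c| < h}, ENNReal.ofReal (ε ^ 2 / Real.sqrt (inner ℝ (Literature.Analysis.FluidPDE.curl (u t) x) (R (EuclideanSpace.single 2 1)) ^ 2 + ε ^ 2) ^ 3 * |fderiv ℝ (fun z => inner ℝ (Literature.Analysis.FluidPDE.curl (u t) z) (R (EuclideanSpace.single 2 1))) x (Literature.Analysis.FluidPDE.curl (u t) x)|)) (nhdsWithin 0 (Set.Ioi 0)) ≤ (M : ENNReal)) → Summit.NavierStokesRegularity.NavierStokesRegularity.Theses.SlicedKelvin.PlanarFluxAPriori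 :=
  fun hL h5 =>
  planarFluxAPriori_of_apexStubs stub_fluxOfCubicDecay stub_vorticityMassBound (stub_slabSplit hL) h5
    stub_decayPersistence

/-- **The crux reduced to the ONE open stub of line `Sketch` (rev 4 of the skeleton).** The slab apex bound
(statement of the registered stub `stub_slabApexBound`, the card's transfer target C⁺ in positive-time form)
implies `Theses.SlicedKelvin.PlanarFluxAPriori`; every other stub of the line is a landed theorem
(`stub_fluxOfCubicDecay`, `stub_vorticityMassBound`, `stub_apexLipschitz`, `stub_slabSplit`,
`stub_decayPersistence`). -/
theorem planarFluxAPriori_of_slabApexBound :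
    (∀ (ν T : ℝ), 0 < ν → 0 < T → ∀ (u : ℝ → EuclideanSpace ℝ (Fin 3) → EuclideanSpace ℝ (Fin 3)) (p : ℝ → EuclideanSpace ℝ (Fin 3) → ℝ), Literature.Analysis.FluidPDE.IsClassicalNSSolutionOn (Set.Ico 0 T) ν 0 u p → Literature.Analysis.FluidPDE.IsLerayHopfOn T ν 0 (u 0) u → Literature.Analysis.FluidPDE.HasRapidSpatialDecay (u 0) → ∀ t₀ ∈ Set.Ioo 0 T, ∃ M : NNReal, ∃ h : ℝ, 0 < h ∧ ∀ t ∈ Set.Ico t₀ T, ∀ (R : EuclideanSpace ℝ (Fin 3) ≃ₗᵢ[ℝ] EuclideanSpace ℝ (Fin 3)) (c : ℝ), Filter.liminf (fun ε : ℝ => ∫⁻ x in {x : EuclideanSpace ℝ (Fin 3) | |inner ℝ x (R (EuclideanSpace.single 2 1)) - c| < h}, ENNReal.ofReal (ε ^ 2 / Real.sqrt (inner ℝ (Literature.Analysis.FluidPDE.curl (u t) x) (R (EuclideanSpace.single 2 1)) ^ 2 + ε ^ 2) ^ 3 * |fderiv ℝ (fun z => inner ℝ (Literature.Analysis.FluidPDE.curl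 (u t) z) (R (EuclideanSpace.single 2 1))) x (Literature.Analysis.FluidPDE.curl (u t) x)|)) (nhdsWithin 0 (Set.Ioi 0)) ≤ (M : ENNReal)) → Summit.NavierStokesRegularity.NavierStokesRegularity.Theses.SlicedKelvin.PlanarFluxAPriori :=
  fun h5 => planarFluxAPriori_of_apexLipschitz_of_slabApexBound stub_apexLipschitz h5

end Summit.NavierStokesRegularity.NavierStokesRegularity.Theorems.SlicedKelvinPlanarFluxAPriori

end
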